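import Summits.CriticalPhenomena.PercolationContinuityZ3.Theorems.PercNearOneGluingNoHeavyLowerTailStarSetForestCertificateTools
import Summits.CriticalPhenomena.PercolationContinuityZ3.Theorems.PercNearOneGluingNoHeavyLowerTailStarSetNestedCertificateCore
import HarnessLib

/-!
# `NoHeavyLowerTail` (stmt-CriticalPhenomena-4575) — the supplies of the mixed certificate: SECOND-ORDER REDUCTION (Step 1 of MWF-CERT §5/§7)

Support file (prover `prim-gen-swap` gen 9; `--supports stmt-CriticalPhenomena-4575`).  No definitions, no named facts, no sorries; Mathlib only.

The two supply inequalities `hU0`, `hU1 r` of `StarSet.setCS_twoPortStarMultigraph_mixed_levelTwo` (…StarSetMixedLevelTwo) read, after division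
by the comonotone coefficient, `Σ_{κ ∈ C_r} Θ_κ Zfar_κ ≤ Π_{I∈F}(1−Θ_I) + x_r + κ₃(r)` with `x_r = Σ_{a ∈ child(r)} Θ_a Π_{b∈F, b<a}(1−Θ_b)`
(`C_r` = chords avoiding `r`, `child(r)` = forest classes whose designated port is `r`; `r`-independent version: `C_r = C`, `child = ∅`).
This file proves the first, purely second-order step of their proof (seat memo MWF-CERT.md §5 Step 1 and §7.2 Step 1'): in the pattern
law of independently open classes (`θ ∈ [0,1]^ι`, adjacency `adj`, "far" = not adjacent),

* `StarSet.supply_reduction_pointwise` — for every set `S` of open classes: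
  `#{κ ∈ C_r : κ ∈ S, far(κ) ∩ S = ∅} ≤ 1[F ∩ S = ∅] + Σ_{a∈Ch} 1[a ∈ S, F_{<a} ∩ S = ∅]
     + Σ_{κ∈C_r} Σ_{I ∈ F∖Ch, I ∼ κ} 1[κ, I ∈ S, far(κ) ∩ S = ∅] + Σ_{κ<κ' ∈ C_r, κ' ∼ κ} 1[κ, κ' ∈ S, far(κ) ∩ S = ∅]`;
* `StarSet.supply_second_order_reduction` — integrating against the pattern weights (`StarSet.cylinder_sum`):
  `Σ_{κ∈C_r} θ_κ Π_{far κ}(1−θ) ≤ Π_F(1−θ) + Σ_{a∈Ch} θ_a Π_{b∈F,b<a}(1−θ_b)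
     + Σ_{κ∈C_r} θ_κ Π_{far κ}(1−θ)·(Σ_{I∈F∖Ch, I∼κ} θ_I + Σ_{κ'∈C_r, κ<κ', κ'∼κ} θ_κ')`.
What remains for U0'/U1'_r is to dominate the right-hand second-order terms by the hair budget `κ₃(r)` (§5 Step 2: two 3-hair patterns per
pair and AM–GM; §7.2: the `r`-defective pairs).
-/

namespace Summit.CriticalPhenomena.PercolationContinuityZ3.Theorems

open Finset
open scoped BigOperators

namespace StarSet

variable {ι : Type*} [Fintype ι] [LinearOrder ι]

/-- **Second-order reduction, pointwise in the set `S` of open classes.**  See the file header. [MWF-CERT.md §5 Step 1, §7.2 Step 1'] -/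
theorem supply_reduction_pointwise (adj : ι → ι → Prop) [DecidableRel adj] (Cr F Ch : Finset ι) (S : Finset ι) :
    (∑ κ ∈ Cr, (if (κ ∈ S ∧ ∀ j ∈ univ.filter (fun j => ¬ adj j κ), j ∉ S) then (1 : ℝ) else 0)) ≤
      (if (∀ I ∈ F, I ∉ S) then (1 : ℝ) else 0) +
      ∑ a ∈ Ch, (if (a ∈ S ∧ ∀ b ∈ F.filter (· < a), b ∉ S) then (1 : ℝ) else 0) +
      ∑ κ ∈ Cr, ∑ I ∈ (F \ Ch).filter (fun I => adj I κ),
        (if (({κ, I} : Finset ι) ⊆ S ∧ ∀ j ∈ univ.filter (fun j => ¬ adj j κ), j ∉ S) then (1 : ℝ) else 0) +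
      ∑ κ ∈ Cr, ∑ κ' ∈ Cr.filter (fun κ' => κ < κ' ∧ adj κ' κ),
        (if (({κ, κ'} : Finset ι) ⊆ S ∧ ∀ j ∈ univ.filter (fun j => ¬ adj j κ), j ∉ S) then (1 : ℝ) else 0) := by
  -- abbreviations
  set g : ι → ℝ := fun κ => if (κ ∈ S ∧ ∀ j ∈ univ.filter (fun j => ¬ adj j κ), j ∉ S) then (1 : ℝ) else 0 with hg
  set cr0 : ℝ := if (∀ I ∈ F, I ∉ S) then (1 : ℝ) else 0 with hcr0
  set crA : ι → ℝ := fun a => if (a ∈ S ∧ ∀ b ∈ F.filter (· < a), b ∉ S) then (1 : ℝ) else 0 with hcrA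
  set sec : ι → ι → ℝ := fun κ I =>
    if (({κ, I} : Finset ι) ⊆ S ∧ ∀ j ∈ univ.filter (fun j => ¬ adj j κ), j ∉ S) then (1 : ℝ) else 0 with hsec
  change ∑ κ ∈ Cr, g κ ≤ cr0 + ∑ a ∈ Ch, crA a + ∑ κ ∈ Cr, ∑ I ∈ (F \ Ch).filter (fun I => adj I κ), sec κ I +
    ∑ κ ∈ Cr, ∑ κ' ∈ Cr.filter (fun κ' => κ < κ' ∧ adj κ' κ), sec κ κ'
  have hg01 : ∀ κ, g κ = 0 ∨ g κ = 1 := fun κ => by simp only [hg]; split_ifs <;> simp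
  have hgnn : ∀ κ, 0 ≤ g κ := fun κ => by rcases hg01 κ with h | h <;> linarith
  have hcr0nn : 0 ≤ cr0 := by simp only [hcr0]; split_ifs <;> norm_num
  have hcrAnn : ∀ a, 0 ≤ crA a := fun a => by simp only [hcrA]; split_ifs <;> norm_num
  have hsecnn : ∀ κ I, 0 ≤ sec κ I := fun κ I => by simp only [hsec]; split_ifs <;> norm_num
  -- on `Ω_κ`, every open class is adjacent to `κ`
  have hΩ : ∀ κ, g κ ≠ 0 → κ ∈ S ∧ ∀ x ∈ S, adj x κ := by
    intro κ hκ
    by_cases h : κ ∈ S ∧ ∀ j ∈ univ.filter (fun j => ¬ adj j κ), j ∉ S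
    · refine ⟨h.1, fun x hx => ?_⟩
      by_contra hadj
      exact h.2 x (mem_filter.2 ⟨mem_univ _, hadj⟩) hx
    · exact absurd (by simp only [hg]; rw [if_neg h]) hκ
  have hsec1 : ∀ κ x, g κ ≠ 0 → x ∈ S → sec κ x = 1 := by
    intro κ x hκ hx
    have h1 := hΩ κ hκ
    have h : κ ∈ S ∧ ∀ j ∈ univ.filter (fun j => ¬ adj j κ), j ∉ S := by
      by_contra h; exact hκ (by simp only [hg]; rw [if_neg h])
    simp only [hsec]
    rw [if_pos ⟨insert_subset_iff.2 ⟨h1.1, singleton_subset_iff.2 hx⟩, h.2⟩]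
  -- (1) at most one more than the pair terms
  have hpairs : ∑ κ ∈ Cr, g κ ≤ 1 + ∑ κ ∈ Cr, ∑ κ' ∈ Cr.filter (fun κ' => κ < κ' ∧ adj κ' κ), sec κ κ' := by
    have hPnn : 0 ≤ ∑ κ ∈ Cr, ∑ κ' ∈ Cr.filter (fun κ' => κ < κ' ∧ adj κ' κ), sec κ κ' :=
      sum_nonneg fun κ _ => sum_nonneg fun κ' _ => hsecnn κ κ'
    by_cases hne : (Cr.filter fun κ => g κ ≠ 0).Nonempty
    · set κ₀ := (Cr.filter fun κ => g κ ≠ 0).min' hne with hκ₀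
      have hκ₀mem : κ₀ ∈ Cr.filter fun κ => g κ ≠ 0 := min'_mem _ _
      have hκ₀Cr : κ₀ ∈ Cr := (mem_filter.1 hκ₀mem).1
      have hκ₀g : g κ₀ ≠ 0 := (mem_filter.1 hκ₀mem).2
      -- every other `Ω`-class is a later class adjacent to `κ₀`
      have hrest : ∑ κ ∈ Cr.erase κ₀, g κ ≤ ∑ κ' ∈ Cr.filter (fun κ' => κ₀ < κ' ∧ adj κ' κ₀), sec κ₀ κ' := by
        rw [sum_filter]
        have hsub : Cr.erase κ₀ ⊆ Cr := erase_subset _ _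
        refine le_trans (sum_le_sum fun κ' hκ' => ?_) (sum_le_sum_of_subset_of_nonneg hsub fun κ' _ _ => ?_)
        · -- termwise on `Cr.erase κ₀`
          show g κ' ≤ if (κ₀ < κ' ∧ adj κ' κ₀) then sec κ₀ κ' else 0
          rcases hg01 κ' with h0 | h1
          · rw [h0]; split_ifs; exacts [hsecnn _ _, le_refl 0]
          · have hκ'g : g κ' ≠ 0 := by rw [h1]; norm_num
            have hκ'S : κ' ∈ S := (hΩ κ' hκ'g).1
            have hne' : κ' ≠ κ₀ := (mem_erase.1 hκ').1
            have hlt : κ₀ < κ' := lt_of_le_of_ne (min'_le _ _ (mem_filter.2 ⟨(mem_erase.1 hκ').2, hκ'g⟩)) hne'.symm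
            have hadj : adj κ' κ₀ := (hΩ κ₀ hκ₀g).2 κ' hκ'S
            rw [if_pos ⟨hlt, hadj⟩, h1, hsec1 κ₀ κ' hκ₀g hκ'S]
        · split_ifs; exacts [hsecnn _ _, le_refl 0]
      have hg1 : g κ₀ = 1 := by rcases hg01 κ₀ with h | h; exacts [absurd h hκ₀g, h]
      rw [← add_sum_erase Cr g hκ₀Cr, hg1]
      refine add_le_add le_rfl (le_trans hrest ?_)
      exact single_le_sum (f := fun κ => ∑ κ' ∈ Cr.filter (fun κ' => κ < κ' ∧ adj κ' κ), sec κ κ')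
        (fun κ _ => sum_nonneg fun κ' _ => hsecnn κ κ') hκ₀Cr
    · have h0 : ∑ κ ∈ Cr, g κ = 0 := by
        refine sum_eq_zero fun κ hκ => ?_
        by_contra h; exact hne ⟨κ, mem_filter.2 ⟨hκ, h⟩⟩
      rw [h0]; linarith
  -- (2) case analysis on the first open forest class
  have htotal_nn : 0 ≤ ∑ κ ∈ Cr, ∑ I ∈ (F \ Ch).filter (fun I => adj I κ), sec κ I :=
    sum_nonneg fun κ _ => sum_nonneg fun I _ => hsecnn κ I
  have hcrA_sum_nn : 0 ≤ ∑ a ∈ Ch, crA a := sum_nonneg fun a _ => hcrAnn a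
  by_cases hF : ∀ I ∈ F, I ∉ S
  · have : cr0 = 1 := by simp only [hcr0]; rw [if_pos hF]
    rw [this]; linarith
  · have hne : (F.filter (· ∈ S)).Nonempty := by
      by_contra h
      apply hF
      intro I hI hIS
      exact h ⟨I, mem_filter.2 ⟨hI, hIS⟩⟩
    set I₀ := (F.filter (· ∈ S)).min' hne with hI₀
    have hI₀mem : I₀ ∈ F.filter (· ∈ S) := min'_mem _ _
    have hI₀F : I₀ ∈ F := (mem_filter.1 hI₀mem).1
    have hI₀S : I₀ ∈ S := (mem_filter.1 hI₀mem).2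
    have hmin : ∀ b ∈ F, b ∈ S → I₀ ≤ b := fun b hb hbS => min'_le _ _ (mem_filter.2 ⟨hb, hbS⟩)
    by_cases hI₀Ch : I₀ ∈ Ch
    · -- the credit term of `a = I₀` is one
      have h1 : crA I₀ = 1 := by
        have hcond : I₀ ∈ S ∧ ∀ b ∈ F.filter (· < I₀), b ∉ S := by
          refine ⟨hI₀S, fun b hb hbS => ?_⟩
          have hb' := mem_filter.1 hb
          exact absurd (hmin b hb'.1 hbS) (not_le.2 hb'.2)
        simp only [hcrA]
        rw [if_pos hcond]
      have h2 : 1 ≤ ∑ a ∈ Ch, crA a := by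
        rw [← h1]; exact single_le_sum (fun a _ => hcrAnn a) hI₀Ch
      linarith
    · -- the pair `(κ, I₀)` is charged for every `Ω`-class `κ`
      have hI₀FC : I₀ ∈ F \ Ch := mem_sdiff.2 ⟨hI₀F, hI₀Ch⟩
      have h3 : ∑ κ ∈ Cr, g κ ≤ ∑ κ ∈ Cr, ∑ I ∈ (F \ Ch).filter (fun I => adj I κ), sec κ I := by
        refine sum_le_sum fun κ _ => ?_
        rcases hg01 κ with h0 | h1
        · rw [h0]; exact sum_nonneg fun I _ => hsecnn κ I
        · have hκg : g κ ≠ 0 := by rw [h1]; norm_num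
          have hadj : adj I₀ κ := (hΩ κ hκg).2 I₀ hI₀S
          rw [h1, ← hsec1 κ I₀ hκg hI₀S]
          exact single_le_sum (f := fun I => sec κ I) (fun I _ => hsecnn κ I) (mem_filter.2 ⟨hI₀FC, hadj⟩)
      have hP : 0 ≤ ∑ κ ∈ Cr, ∑ κ' ∈ Cr.filter (fun κ' => κ < κ' ∧ adj κ' κ), sec κ κ' :=
        sum_nonneg fun κ _ => sum_nonneg fun κ' _ => hsecnn κ κ'
      linarith

/-- **Second-order reduction of the supply inequalities** (integrated form).  See the file header. [MWF-CERT.md §5 Step 1, §7.2 Step 1'] -/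
theorem supply_second_order_reduction (θ : ι → ℝ) (hθ0 : ∀ i, 0 ≤ θ i) (hθ1 : ∀ i, θ i ≤ 1)
    (adj : ι → ι → Prop) [DecidableRel adj] (Cr F Ch : Finset ι) (hCF : Disjoint Cr F) (hrefl : ∀ κ ∈ Cr, adj κ κ) :
    ∑ κ ∈ Cr, θ κ * ∏ j ∈ univ.filter (fun j => ¬ adj j κ), (1 - θ j) ≤
      (∏ I ∈ F, (1 - θ I) + ∑ a ∈ Ch, θ a * ∏ b ∈ F.filter (· < a), (1 - θ b)) +
      ∑ κ ∈ Cr, (θ κ * ∏ j ∈ univ.filter (fun j => ¬ adj j κ), (1 - θ j)) *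
        (∑ I ∈ (F \ Ch).filter (fun I => adj I κ), θ I + ∑ κ' ∈ Cr.filter (fun κ' => κ < κ' ∧ adj κ' κ), θ κ') := by
  set W : Finset ι → ℝ := fun S => (∏ k ∈ S, θ k) * ∏ k ∈ univ \ S, (1 - θ k) with hW
  have hWnn : ∀ S, 0 ≤ W S := fun S => patternWeight_nonneg θ hθ0 hθ1 S
  set PS := (univ : Finset ι).powerset with hPS
  set far : ι → Finset ι := fun κ => univ.filter (fun j => ¬ adj j κ) with hfar
  have hκfar : ∀ κ ∈ Cr, κ ∉ far κ := fun κ hκ h => (mem_filter.1 h).2 (hrefl κ hκ)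
  -- integrate the pointwise inequality
  have hint := sum_le_sum fun S (_ : S ∈ PS) =>
    mul_le_mul_of_nonneg_left (supply_reduction_pointwise adj Cr F Ch S) (hWnn S)
  -- evaluate the left-hand side
  have hL : ∑ S ∈ PS, W S * ∑ κ ∈ Cr, (if (κ ∈ S ∧ ∀ j ∈ univ.filter (fun j => ¬ adj j κ), j ∉ S) then (1 : ℝ) else 0) =
      ∑ κ ∈ Cr, θ κ * ∏ j ∈ far κ, (1 - θ j) := by
    rw [show (∑ S ∈ PS, W S * ∑ κ ∈ Cr, (if (κ ∈ S ∧ ∀ j ∈ univ.filter (fun j => ¬ adj j κ), j ∉ S) then (1 : ℝ) else 0)) =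
        ∑ κ ∈ Cr, ∑ S ∈ PS, W S * (if (κ ∈ S ∧ ∀ j ∈ far κ, j ∉ S) then (1 : ℝ) else 0) by
      rw [sum_comm]; exact sum_congr rfl fun S _ => by rw [mul_sum]]
    exact sum_congr rfl fun κ hκ => cylinder_sum_one_open θ κ (far κ) (hκfar κ hκ)
  -- evaluate the right-hand side
  have hR0 : ∑ S ∈ PS, W S * (if (∀ I ∈ F, I ∉ S) then (1 : ℝ) else 0) = ∏ I ∈ F, (1 - θ I) := cylinder_sum_closed θ F
  have hRA : ∑ S ∈ PS, W S * ∑ a ∈ Ch, (if (a ∈ S ∧ ∀ b ∈ F.filter (· < a), b ∉ S) then (1 : ℝ) else 0) =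
      ∑ a ∈ Ch, θ a * ∏ b ∈ F.filter (· < a), (1 - θ b) := by
    rw [show (∑ S ∈ PS, W S * ∑ a ∈ Ch, (if (a ∈ S ∧ ∀ b ∈ F.filter (· < a), b ∉ S) then (1 : ℝ) else 0)) =
        ∑ a ∈ Ch, ∑ S ∈ PS, W S * (if (a ∈ S ∧ ∀ b ∈ F.filter (· < a), b ∉ S) then (1 : ℝ) else 0) by
      rw [sum_comm]; exact sum_congr rfl fun S _ => by rw [mul_sum]]
    exact sum_congr rfl fun a _ => cylinder_sum_one_open θ a (F.filter (· < a)) (by simp)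
  have hpair : ∀ κ ∈ Cr, ∀ x, adj x κ → x ≠ κ →
      ∑ S ∈ PS, W S * (if (({κ, x} : Finset ι) ⊆ S ∧ ∀ j ∈ univ.filter (fun j => ¬ adj j κ), j ∉ S) then (1 : ℝ) else 0) =
        θ κ * θ x * ∏ j ∈ far κ, (1 - θ j) := by
    intro κ hκ x hx hxκ
    have hdisj : Disjoint ({κ, x} : Finset ι) (far κ) := by
      rw [disjoint_insert_left, disjoint_singleton_left]
      exact ⟨hκfar κ hκ, fun h => (mem_filter.1 h).2 hx⟩
    rw [cylinder_sum θ {κ, x} (far κ) hdisj, prod_pair hxκ.symm]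
  have hswap : ∀ (T : ι → Finset ι) (f : ι → ι → Finset ι → ℝ),
      ∑ S ∈ PS, W S * ∑ κ ∈ Cr, ∑ I ∈ T κ, f κ I S = ∑ κ ∈ Cr, ∑ I ∈ T κ, ∑ S ∈ PS, W S * f κ I S := by
    intro T f
    calc ∑ S ∈ PS, W S * ∑ κ ∈ Cr, ∑ I ∈ T κ, f κ I S
        = ∑ S ∈ PS, ∑ κ ∈ Cr, ∑ I ∈ T κ, W S * f κ I S := by
          refine sum_congr rfl fun S _ => ?_
          rw [mul_sum]
          exact sum_congr rfl fun κ _ => by rw [mul_sum]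
      _ = ∑ κ ∈ Cr, ∑ S ∈ PS, ∑ I ∈ T κ, W S * f κ I S := sum_comm
      _ = ∑ κ ∈ Cr, ∑ I ∈ T κ, ∑ S ∈ PS, W S * f κ I S := sum_congr rfl fun κ _ => sum_comm
  have hR2 : ∑ S ∈ PS, W S * ∑ κ ∈ Cr, ∑ I ∈ (F \ Ch).filter (fun I => adj I κ),
      (if (({κ, I} : Finset ι) ⊆ S ∧ ∀ j ∈ univ.filter (fun j => ¬ adj j κ), j ∉ S) then (1 : ℝ) else 0) =
      ∑ κ ∈ Cr, ∑ I ∈ (F \ Ch).filter (fun I => adj I κ), θ κ * θ I * ∏ j ∈ far κ, (1 - θ j) := by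
    rw [hswap (fun κ => (F \ Ch).filter (fun I => adj I κ))
      (fun κ I S => if (({κ, I} : Finset ι) ⊆ S ∧ ∀ j ∈ univ.filter (fun j => ¬ adj j κ), j ∉ S) then (1 : ℝ) else 0)]
    refine sum_congr rfl fun κ hκ => sum_congr rfl fun I hI => ?_
    have hI' := mem_filter.1 hI
    exact hpair κ hκ I hI'.2 (fun h => disjoint_left.1 hCF hκ (h ▸ (mem_sdiff.1 hI'.1).1))
  have hR3 : ∑ S ∈ PS, W S * ∑ κ ∈ Cr, ∑ κ' ∈ Cr.filter (fun κ' => κ < κ' ∧ adj κ' κ),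
      (if (({κ, κ'} : Finset ι) ⊆ S ∧ ∀ j ∈ univ.filter (fun j => ¬ adj j κ), j ∉ S) then (1 : ℝ) else 0) =
      ∑ κ ∈ Cr, ∑ κ' ∈ Cr.filter (fun κ' => κ < κ' ∧ adj κ' κ), θ κ * θ κ' * ∏ j ∈ far κ, (1 - θ j) := by
    rw [hswap (fun κ => Cr.filter (fun κ' => κ < κ' ∧ adj κ' κ))
      (fun κ κ' S => if (({κ, κ'} : Finset ι) ⊆ S ∧ ∀ j ∈ univ.filter (fun j => ¬ adj j κ), j ∉ S) then (1 : ℝ) else 0)]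
    refine sum_congr rfl fun κ hκ => sum_congr rfl fun κ' hκ' => ?_
    have h' := (mem_filter.1 hκ').2
    exact hpair κ hκ κ' h'.2 (ne_of_gt h'.1)
  -- assemble
  have hlhs : ∑ S ∈ PS, W S * ∑ κ ∈ Cr, (if (κ ∈ S ∧ ∀ j ∈ univ.filter (fun j => ¬ adj j κ), j ∉ S) then (1 : ℝ) else 0) =
      ∑ κ ∈ Cr, θ κ * ∏ j ∈ univ.filter (fun j => ¬ adj j κ), (1 - θ j) := hL
  have hrhs : ∑ S ∈ PS, W S * ((if (∀ I ∈ F, I ∉ S) then (1 : ℝ) else 0) +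
      ∑ a ∈ Ch, (if (a ∈ S ∧ ∀ b ∈ F.filter (· < a), b ∉ S) then (1 : ℝ) else 0) +
      ∑ κ ∈ Cr, ∑ I ∈ (F \ Ch).filter (fun I => adj I κ),
        (if (({κ, I} : Finset ι) ⊆ S ∧ ∀ j ∈ univ.filter (fun j => ¬ adj j κ), j ∉ S) then (1 : ℝ) else 0) +
      ∑ κ ∈ Cr, ∑ κ' ∈ Cr.filter (fun κ' => κ < κ' ∧ adj κ' κ),
        (if (({κ, κ'} : Finset ι) ⊆ S ∧ ∀ j ∈ univ.filter (fun j => ¬ adj j κ), j ∉ S) then (1 : ℝ) else 0)) =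
      (∏ I ∈ F, (1 - θ I) + ∑ a ∈ Ch, θ a * ∏ b ∈ F.filter (· < a), (1 - θ b)) +
      ∑ κ ∈ Cr, (θ κ * ∏ j ∈ univ.filter (fun j => ¬ adj j κ), (1 - θ j)) *
        (∑ I ∈ (F \ Ch).filter (fun I => adj I κ), θ I + ∑ κ' ∈ Cr.filter (fun κ' => κ < κ' ∧ adj κ' κ), θ κ') := by
    have hsplit : ∀ S ∈ PS, W S * ((if (∀ I ∈ F, I ∉ S) then (1 : ℝ) else 0) +
        ∑ a ∈ Ch, (if (a ∈ S ∧ ∀ b ∈ F.filter (· < a), b ∉ S) then (1 : ℝ) else 0) +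
        ∑ κ ∈ Cr, ∑ I ∈ (F \ Ch).filter (fun I => adj I κ),
          (if (({κ, I} : Finset ι) ⊆ S ∧ ∀ j ∈ univ.filter (fun j => ¬ adj j κ), j ∉ S) then (1 : ℝ) else 0) +
        ∑ κ ∈ Cr, ∑ κ' ∈ Cr.filter (fun κ' => κ < κ' ∧ adj κ' κ),
          (if (({κ, κ'} : Finset ι) ⊆ S ∧ ∀ j ∈ univ.filter (fun j => ¬ adj j κ), j ∉ S) then (1 : ℝ) else 0)) =
        W S * (if (∀ I ∈ F, I ∉ S) then (1 : ℝ) else 0) +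
        W S * ∑ a ∈ Ch, (if (a ∈ S ∧ ∀ b ∈ F.filter (· < a), b ∉ S) then (1 : ℝ) else 0) +
        W S * ∑ κ ∈ Cr, ∑ I ∈ (F \ Ch).filter (fun I => adj I κ),
          (if (({κ, I} : Finset ι) ⊆ S ∧ ∀ j ∈ univ.filter (fun j => ¬ adj j κ), j ∉ S) then (1 : ℝ) else 0) +
        W S * ∑ κ ∈ Cr, ∑ κ' ∈ Cr.filter (fun κ' => κ < κ' ∧ adj κ' κ),
          (if (({κ, κ'} : Finset ι) ⊆ S ∧ ∀ j ∈ univ.filter (fun j => ¬ adj j κ), j ∉ S) then (1 : ℝ) else 0) := by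
      intro S _; ring
    rw [sum_congr rfl hsplit, sum_add_distrib, sum_add_distrib, sum_add_distrib, hR0, hRA, hR2, hR3]
    have hκ : ∀ κ ∈ Cr, (∑ I ∈ (F \ Ch).filter (fun I => adj I κ), θ κ * θ I * ∏ j ∈ far κ, (1 - θ j)) +
        ∑ κ' ∈ Cr.filter (fun κ' => κ < κ' ∧ adj κ' κ), θ κ * θ κ' * ∏ j ∈ far κ, (1 - θ j) =
        (θ κ * ∏ j ∈ univ.filter (fun j => ¬ adj j κ), (1 - θ j)) *
          (∑ I ∈ (F \ Ch).filter (fun I => adj I κ), θ I + ∑ κ' ∈ Cr.filter (fun κ' => κ < κ' ∧ adj κ' κ), θ κ') := by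
      intro κ _
      rw [mul_add, mul_sum, mul_sum]
      congr 1
      · exact sum_congr rfl fun I _ => by ring
      · exact sum_congr rfl fun κ' _ => by ring
    rw [add_assoc, ← sum_add_distrib, sum_congr rfl hκ]
  rw [hlhs, hrhs] at hint
  exact hint

end StarSet

end Summit.CriticalPhenomena.PercolationContinuityZ3.Theorems
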